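import Mathlib
import HarnessLib
import Literature.MathematicalPhysics.QuantumLattice.GaugeGroups
import Literature.LinearAlgebra.Matrix.UnitaryGroupMaximalTorus
import Literature.LinearAlgebra.Matrix.SpecialUnitaryGroupConjugacyClasses
import Summits.Ventures.LatticeQCDFlow.Exactness.FlowPushforward
import Summits.Ventures.LatticeQCDFlow.Exactness.CircleGroupJacobian
import Summits.Ventures.LatticeQCDFlow.Exactness.SpectralKernelJacobianWeylShapeSU
import Summits.Ventures.LatticeQCDFlow.Exactness.TorusCircleChart
import Summits.Ventures.LatticeQCDFlow.Scaling.EntropyBudgetCoupling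

/-!
# The circle chart of the special diagonal torus `SΔ(n)`: `N − 1` free eigen-phases present Haar, and torus maps inherit circle Jacobians

HONEST FRAMING: exact (Metropolis-corrected) sampling algorithms for lattice gauge theory;
figures of merit are autocorrelation/cost numbers at stated couplings and volumes; no
continuum-physics claim.

Venture `LatticeQCDFlow` (cell pub-lqcd), topic `Exactness`; FANOUT row 10 (`eng-equiv`, engine
`latflow.equiv` / `latflow.flows_jax`, `spectral.py`: the `SU(N)` spectral kernel's box flow acts on
the `N − 1` independent eigen-phases, the last phase being fixed by `det = 1`).  NEW WORK of the cell,
the `SU(n)` sequel of `TorusCircleChart.lean` (`hasJacobian_of_presentation`,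
`map_eq_haarProbability_of_mul_of_surjective`), over Mathlib and the tree's
`Literature/LinearAlgebra/Matrix/UnitaryGroupMaximalTorus.lean` (`SΔ(n)`).  Nothing is cited as a
fact; no number; no definition (the chart enters through the characterising hypothesis `he` — its
free diagonal entries — and an existence theorem).  Printed counterparts, NAMED ONLY: Bröcker–tom
Dieck IV (3.1) ("the torus `SΔ(n)` has dimension `n − 1`"); Boyda et al., PRD 103 (2021) 074504,
App. B Algorithm 2.

## What is typed (`i₀ : n` the dependent phase; `e : ({i // i ≠ i₀} → U(1)) → SΔ(n)` any map whose
free diagonal entries are `z i`)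

* `diagonal_extend_mem_specialUnitaryGroup`, **`exists_circleChart_specialDiagonalTorus`** (the chart
  `z ↦ diag(ẑ)`, `ẑ_{i₀} = (∏ z)⁻¹`, exists and is continuous);
* `circleChart_specialDiagonalTorus_apply_self` (the dependent entry IS `(∏ z)⁻¹`),
  `coe_circleChart_specialDiagonalTorus`, `…_mul`, `…_bijective_continuous`;
* **`map_circleChart_pi_haar_specialDiagonalTorus`** — `e_* (⊗_{i ≠ i₀} Haar_{U(1)}) = Haar_{SΔ(n)}`
  (uniqueness of Haar measure on the compact group `SΔ(n)`);
* **`hasJacobian_specialDiagonalTorus_of_circleChart`** — a torus map `F` intertwined with a flow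
  `F'` of the free phases, `F ∘ e = e ∘ F'`, with `J ∘ e = J'`, inherits `HasJacobian`: this IS the
  hypothesis `hfJ` of `hasJacobian_spectralKernel_specialUnitaryGroup_of_weyl` read in eigen-phase
  coordinates; **`hasJacobian_specialDiagonalTorus_pointwise`** — independent per-phase circle maps.

NOT here: the engine's simplex/box cell coordinates for `N ≥ 3` (Weyl alcove); Weyl's integral
formula; any number.
-/

noncomputable section

namespace Summit.Ventures.LatticeQCDFlow.Exactness

open MeasureTheory Matrix Topology
open Literature.LinearAlgebra.Matrix
open Literature.MathematicalPhysics.QuantumFieldTheory (haarProbability)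
open scoped ENNReal

variable {n : Type*} [Fintype n] [DecidableEq n]

/-! ## `SU(n)`: the circle schart of `SΔ(n)` with dependent phase `i₀` -/

section SpecialUnitary

variable (i₀ : n)

omit [DecidableEq n] in
/-- The coercion `Circle → ℂ` is multiplicative on finite products. -/
private theorem coe_finset_prod_circle' {ι : Type*} (s : Finset ι) (f : ι → Circle) :
    ((∏ i ∈ s, f i : Circle) : ℂ) = ∏ i ∈ s, (f i : ℂ) :=
  map_prod Circle.coeHom f s

/-- The free phases `z`, extended by the dependent phase `(∏ z)⁻¹` at `i₀`, give a diagonal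
element of `SU(n)`. -/
theorem diagonal_extend_mem_specialUnitaryGroup (z : {i : n // i ≠ i₀} → Circle) :
    diagonal (fun i => ((if h : i = i₀ then (∏ j, z j)⁻¹ else z ⟨i, h⟩ : Circle) : ℂ)) ∈
      Matrix.specialUnitaryGroup n ℂ := by
  refine (Literature.MathematicalPhysics.QuantumLattice.diagonal_mem_specialUnitaryGroup_iff _).mpr
    ⟨fun i => Circle.norm_coe _, ?_⟩
  rw [← coe_finset_prod_circle' Finset.univ]
  have hsplit : (∏ i, (if h : i = i₀ then (∏ j, z j)⁻¹ else z ⟨i, h⟩ : Circle)) =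
      (∏ j, z j)⁻¹ * ∏ j : {i : n // i ≠ i₀}, z j := by
    rw [← Finset.prod_erase_mul _ _ (Finset.mem_univ i₀), dif_pos rfl, mul_comm]
    congr 1
    refine Finset.prod_bij' (fun i hi => ⟨i, (Finset.mem_erase.mp hi).1⟩) (fun j _ => (j : n))
      (fun i hi => Finset.mem_univ _)
      (fun j _ => Finset.mem_erase.mpr ⟨j.2, Finset.mem_univ _⟩)
      (fun i hi => rfl) (fun j _ => rfl) (fun i hi => ?_)
    rw [dif_neg (Finset.mem_erase.mp hi).1]
  rw [hsplit, inv_mul_cancel, Circle.coe_one]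

/-- **The circle schart of `SΔ(n)` exists and is continuous**: `z ↦ diag(ẑ)` with `ẑ` the
extension of the free phases by the dependent one. -/
theorem exists_circleChart_specialDiagonalTorus :
    ∃ schart : ({i : n // i ≠ i₀} → Circle) → specialDiagonalTorus n, Continuous schart ∧
      ∀ z (i : {i : n // i ≠ i₀}),
        (((schart z : specialDiagonalTorus n) : Matrix.specialUnitaryGroup n ℂ) : Matrix n n ℂ) i i = (z i : ℂ) := by
  let schart : ({i : n // i ≠ i₀} → Circle) → specialDiagonalTorus n := fun z =>
    ⟨⟨diagonal (fun i => ((if h : i = i₀ then (∏ j, z j)⁻¹ else z ⟨i, h⟩ : Circle) : ℂ)),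
      diagonal_extend_mem_specialUnitaryGroup i₀ z⟩, ⟨_, rfl⟩⟩
  refine ⟨schart, ?_, fun z i => ?_⟩
  · refine continuous_induced_rng.2 (continuous_induced_rng.2 ?_)
    change Continuous fun z : {i : n // i ≠ i₀} → Circle =>
      diagonal (fun i => ((if h : i = i₀ then (∏ j, z j)⁻¹ else z ⟨i, h⟩ : Circle) : ℂ))
    refine (continuous_pi fun i => continuous_subtype_val.comp ?_).matrix_diagonal
    by_cases h : i = i₀
    · simp only [h, dite_true]
      exact (continuous_finsetProd _ fun j _ =>
        (continuous_apply j : Continuous fun z : {i : n // i ≠ i₀} → Circle => z j)).inv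
    · simp only [h, dite_false]
      exact (continuous_apply _ : Continuous fun z : {i : n // i ≠ i₀} → Circle => z ⟨i, h⟩)
  · change (diagonal (fun i => ((if h : i = i₀ then (∏ j, z j)⁻¹ else z ⟨i, h⟩ : Circle) : ℂ))) i i = _
    rw [diagonal_apply_eq, dif_neg i.2]

variable {i₀} {schart : ({i : n // i ≠ i₀} → Circle) → specialDiagonalTorus n}
  (he : ∀ z (i : {i : n // i ≠ i₀}),
    (((schart z : specialDiagonalTorus n) : Matrix.specialUnitaryGroup n ℂ) : Matrix n n ℂ) i i = (z i : ℂ))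

include he

/-- **The dependent entry**: the `i₀`-th diagonal entry of `schart z` is `(∏ z)⁻¹` (determinant one). -/
theorem circleChart_specialDiagonalTorus_apply_self (z : {i : n // i ≠ i₀} → Circle) :
    (((schart z : specialDiagonalTorus n) : Matrix.specialUnitaryGroup n ℂ) : Matrix n n ℂ) i₀ i₀ =
      (((∏ j, z j)⁻¹ : Circle) : ℂ) := by
  set d : n → ℂ := fun i => (((schart z : specialDiagonalTorus n) : Matrix.specialUnitaryGroup n ℂ) :
    Matrix n n ℂ) i i with hd
  have hdiag := coe_specialDiagonalTorus_eq_diagonal (schart z)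
  obtain ⟨-, hprod⟩ := norm_eq_one_and_prod_eq_one_of_mem_specialDiagonalTorus hdiag
  -- `∏_i d i = d i₀ * ∏_{i ≠ i₀} z i = 1`
  have hsplit : ∏ i, d i = d i₀ * ∏ j : {i : n // i ≠ i₀}, (z j : ℂ) := by
    rw [← Finset.prod_erase_mul _ _ (Finset.mem_univ i₀), mul_comm]
    congr 1
    refine Finset.prod_bij' (fun i hi => ⟨i, (Finset.mem_erase.mp hi).1⟩) (fun j _ => (j : n))
      (fun i hi => Finset.mem_univ _)
      (fun j _ => Finset.mem_erase.mpr ⟨j.2, Finset.mem_univ _⟩)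
      (fun i hi => rfl) (fun j _ => rfl) (fun i hi => ?_)
    exact he z ⟨i, (Finset.mem_erase.mp hi).1⟩
  have hP : ((∏ j, z j : Circle) : ℂ) = ∏ j : {i : n // i ≠ i₀}, (z j : ℂ) :=
    coe_finset_prod_circle' Finset.univ z
  have hP0 : ((∏ j, z j : Circle) : ℂ) ≠ 0 := Circle.coe_ne_zero _
  change d i₀ = _
  rw [Circle.coe_inv]
  refine eq_inv_of_mul_eq_one_left ?_
  rw [hP, ← hsplit]
  exact hprod

/-- The matrix of `schart z` is the diagonal matrix of the extended phases. -/
theorem coe_circleChart_specialDiagonalTorus (z : {i : n // i ≠ i₀} → Circle) :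
    (((schart z : specialDiagonalTorus n) : Matrix.specialUnitaryGroup n ℂ) : Matrix n n ℂ) =
      diagonal (fun i => ((if h : i = i₀ then (∏ j, z j)⁻¹ else z ⟨i, h⟩ : Circle) : ℂ)) := by
  rw [coe_specialDiagonalTorus_eq_diagonal (schart z)]
  refine congrArg diagonal (funext fun i => ?_)
  by_cases h : i = i₀
  · subst h
    rw [dif_pos rfl, circleChart_specialDiagonalTorus_apply_self he]
  · rw [dif_neg h, he z ⟨i, h⟩]

/-- The schart is multiplicative. -/
theorem circleChart_specialDiagonalTorus_mul (z w : {i : n // i ≠ i₀} → Circle) :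
    schart (z * w) = schart z * schart w := by
  apply Subtype.ext
  apply Subtype.ext
  change (((schart (z * w) : specialDiagonalTorus n) : Matrix.specialUnitaryGroup n ℂ) : Matrix n n ℂ) =
    (((schart z : specialDiagonalTorus n) : Matrix.specialUnitaryGroup n ℂ) : Matrix n n ℂ) *
      (((schart w : specialDiagonalTorus n) : Matrix.specialUnitaryGroup n ℂ) : Matrix n n ℂ)
  rw [coe_circleChart_specialDiagonalTorus he, coe_circleChart_specialDiagonalTorus he,
    coe_circleChart_specialDiagonalTorus he, diagonal_mul_diagonal]
  refine congrArg diagonal (funext fun i => ?_)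
  by_cases h : i = i₀
  · simp only [h, dite_true, Pi.mul_apply, Finset.prod_mul_distrib, mul_inv, Circle.coe_mul]
  · simp only [h, dite_false, Pi.mul_apply, Circle.coe_mul]

/-- **The schart is a continuous (hence measurable) bijection** `U(1)^{n−1} → SΔ(n)` (injective:
the free entries are read off the matrix; surjective: the free entries of a point of `SΔ(n)` are
unimodular and determinant one fixes the last). -/
theorem circleChart_specialDiagonalTorus_bijective_continuous :
    Function.Bijective schart ∧ Continuous schart ∧ Measurable schart := by
  haveI : SecondCountableTopology (specialDiagonalTorus n) := secondCountableTopology_specialDiagonalTorus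
  have hinj : Function.Injective schart := by
    intro z w h
    funext i
    apply Circle.ext
    rw [← he z i, ← he w i, h]
  have hsurj : Function.Surjective schart := by
    intro t
    have hdiag := coe_specialDiagonalTorus_eq_diagonal t
    set d : n → ℂ := fun i => ((t : Matrix.specialUnitaryGroup n ℂ) : Matrix n n ℂ) i i with hd
    obtain ⟨hd1, hprod⟩ := norm_eq_one_and_prod_eq_one_of_mem_specialDiagonalTorus hdiag
    set z : {i : n // i ≠ i₀} → Circle := fun i => ⟨d i, mem_sphere_zero_iff_norm.mpr (hd1 i)⟩ with hz
    refine ⟨z, ?_⟩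
    -- two points of `SΔ(n)` with the same free entries coincide (determinant one fixes the last)
    have hfree : ∀ i : {i : n // i ≠ i₀},
        (((schart z : specialDiagonalTorus n) : Matrix.specialUnitaryGroup n ℂ) : Matrix n n ℂ) i i = d i :=
      fun i => he z i
    have hsplit : ∀ (c : n → ℂ), ∏ i, c i = c i₀ * ∏ j : {i : n // i ≠ i₀}, c j := by
      intro c
      rw [← Finset.prod_erase_mul _ _ (Finset.mem_univ i₀), mul_comm]
      congr 1
      exact Finset.prod_bij' (fun i hi => ⟨i, (Finset.mem_erase.mp hi).1⟩) (fun j _ => (j : n))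
        (fun i hi => Finset.mem_univ _)
        (fun j _ => Finset.mem_erase.mpr ⟨j.2, Finset.mem_univ _⟩)
        (fun i hi => rfl) (fun j _ => rfl) (fun i hi => rfl)
    have hlast : (((schart z : specialDiagonalTorus n) : Matrix.specialUnitaryGroup n ℂ) : Matrix n n ℂ) i₀ i₀ =
        d i₀ := by
      rw [circleChart_specialDiagonalTorus_apply_self he, Circle.coe_inv,
        coe_finset_prod_circle' Finset.univ]
      have hP : ∏ j : {i : n // i ≠ i₀}, (z j : ℂ) = ∏ j : {i : n // i ≠ i₀}, d j := rfl
      have hne : ∏ j : {i : n // i ≠ i₀}, d j ≠ 0 :=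
        Finset.prod_ne_zero_iff.mpr fun j _ => fun h0 => by
          have := hd1 j; rw [h0, norm_zero] at this; exact zero_ne_one this
      rw [hP]
      refine inv_eq_of_mul_eq_one_right ?_
      rw [mul_comm, ← hsplit]
      exact hprod
    apply Subtype.ext
    apply Subtype.ext
    rw [coe_specialDiagonalTorus_eq_diagonal (schart z), hdiag]
    refine congrArg diagonal (funext fun i => ?_)
    by_cases h : i = i₀
    · subst h; exact hlast
    · exact hfree ⟨i, h⟩
  have hcont : Continuous schart := by
    refine continuous_induced_rng.2 (continuous_induced_rng.2 ?_)
    have hfun : (fun z => (((schart z : specialDiagonalTorus n) : Matrix.specialUnitaryGroup n ℂ) : Matrix n n ℂ)) =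
        fun z => diagonal (fun i => ((if h : i = i₀ then (∏ j, z j)⁻¹ else z ⟨i, h⟩ : Circle) : ℂ)) :=
      funext fun z => coe_circleChart_specialDiagonalTorus he z
    change Continuous fun z => (((schart z : specialDiagonalTorus n) : Matrix.specialUnitaryGroup n ℂ) : Matrix n n ℂ)
    rw [hfun]
    refine (continuous_pi fun i => continuous_subtype_val.comp ?_).matrix_diagonal
    by_cases h : i = i₀
    · simp only [h, dite_true]
      exact (continuous_finsetProd _ fun j _ =>
        (continuous_apply j : Continuous fun z : {i : n // i ≠ i₀} → Circle => z j)).inv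
    · simp only [h, dite_false]
      exact (continuous_apply _ : Continuous fun z : {i : n // i ≠ i₀} → Circle => z ⟨i, h⟩)
  exact ⟨⟨hinj, hsurj⟩, hcont, hcont.measurable⟩

/-- **The circle schart presents Haar**: `e_* (⊗_{i ≠ i₀} Haar_{U(1)}) = Haar_{SΔ(n)}`. -/
theorem map_circleChart_pi_haar_specialDiagonalTorus :
    Measure.map schart (Measure.pi fun _ : {i : n // i ≠ i₀} => haarProbability Circle) =
      haarProbability (specialDiagonalTorus n) := by
  haveI : SecondCountableTopology (specialDiagonalTorus n) := secondCountableTopology_specialDiagonalTorus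
  exact map_eq_haarProbability_of_mul_of_surjective _
    (circleChart_specialDiagonalTorus_bijective_continuous he).2.2
    (circleChart_specialDiagonalTorus_mul he) (circleChart_specialDiagonalTorus_bijective_continuous he).1.2

/-- **Torus maps in eigen-phase coordinates (`SU(n)`).**  If
`F' : ({i // i ≠ i₀} → U(1)) → ({i // i ≠ i₀} → U(1))` — a flow of the `N − 1` free eigen-phases —
has Jacobian `J'` for `⊗ Haar_{U(1)}`, and `F`, `J` on `SΔ(n)` are measurable with
`F (schart z) = schart (F' z)` and `J (schart z) = J' z`, then `HasJacobian (Haar SΔ(n)) F J` — the hypothesis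
`hfJ` of `hasJacobian_spectralKernel_specialUnitaryGroup_of_weyl`. -/
theorem hasJacobian_specialDiagonalTorus_of_circleChart
    {F' : ({i : n // i ≠ i₀} → Circle) → ({i : n // i ≠ i₀} → Circle)}
    {J' : ({i : n // i ≠ i₀} → Circle) → ℝ≥0∞}
    (hF' : HasJacobian (Measure.pi fun _ : {i : n // i ≠ i₀} => haarProbability Circle) F' J')
    {F : specialDiagonalTorus n → specialDiagonalTorus n} (hF : Measurable F)
    {J : specialDiagonalTorus n → ℝ≥0∞} (hJ : Measurable J) (hcomm : ∀ z, F (schart z) = schart (F' z))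
    (hJ' : ∀ z, J (schart z) = J' z) : HasJacobian (haarProbability (specialDiagonalTorus n)) F J :=
  hasJacobian_of_presentation (circleChart_specialDiagonalTorus_bijective_continuous he).2.2
    (map_circleChart_pi_haar_specialDiagonalTorus he) hF' hF hJ hcomm hJ'

/-- **Independent per-phase circle maps are exact on `SΔ(n)`**: if each free phase `i ≠ i₀` is
moved by a circle map `ψ i` with Jacobian `J i` (finite) for `Haar_{U(1)}` (the dependent phase
following by determinant one), and `F`, `Jt` on `SΔ(n)` are measurable with
`F (schart z) = schart (fun i => ψ i (z i))`, `Jt (schart z) = ∏ i, J i (z i)`, then `HasJacobian (Haar SΔ(n)) F Jt`. -/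
theorem hasJacobian_specialDiagonalTorus_pointwise {ψ : {i : n // i ≠ i₀} → Circle → Circle}
    {J : {i : n // i ≠ i₀} → Circle → ℝ≥0∞}
    (hψ : ∀ i, HasJacobian (haarProbability Circle) (ψ i) (J i)) (hJtop : ∀ i x, J i x ≠ ∞)
    {F : specialDiagonalTorus n → specialDiagonalTorus n} (hF : Measurable F)
    {Jt : specialDiagonalTorus n → ℝ≥0∞} (hJt : Measurable Jt)
    (hcomm : ∀ z, F (schart z) = schart fun i => ψ i (z i)) (hJ' : ∀ z, Jt (schart z) = ∏ i, J i (z i)) :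
    HasJacobian (haarProbability (specialDiagonalTorus n)) F Jt :=
  hasJacobian_specialDiagonalTorus_of_circleChart he
    (Theory2.hasJacobian_pointwise (haarProbability Circle) hψ hJtop) hF hJt hcomm hJ'

end SpecialUnitary

end Summit.Ventures.LatticeQCDFlow.Exactness
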